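import Mathlib
import Summits.ValiantsHypothesis.ValiantsHypothesis.Theorems.LacunarySymmetroidMatrixDescartesLocalMultiplicityDefs
import Summits.ValiantsHypothesis.ValiantsHypothesis.Theorems.LacunarySymmetroidMatrixDescartesStubDescartesCeiling

/-!
# `MatrixDescartes` (stmt-ValiantsHypothesis-18050) — the LOCAL (multiplicity) census column: three rows

HONEST FRAMING.  Helper file (`--supports stmt-ValiantsHypothesis-18050 --as helper`) for the crux
`Summit.ValiantsHypothesis.ValiantsHypothesis.Theses.LacunarySymmetroid.MatrixDescartes` (route `LacunarySymmetroid`).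
It fills three rows of the LOCAL census column `LocalRootLawAt m K B` («`μ(m,K) ≤ B`»: order of vanishing at `t = 1`
of the determinant of a `K`-term real symmetric `m × m` lacunary pencil; vocabulary file
`LacunarySymmetroidMatrixDescartesLocalMultiplicityDefs.lean`), as priced by both critics of the crux-idea
«local-multiplicity-law» (ideator val-idea-4, 2026-08-27; PASS-WITH-PRICE, tier INSTRUMENT/RECORD):

* `stub_localDescartes m K : LocalRootLawAt m K (C(m+K−1, m) − 1)` — the local Descartes ceiling: the pencil
  determinant has at most `C(m+K−1, m)` monomials (tree `StubDescartesCeiling.card_support_det_pencil_le`) and a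
  non-zero real polynomial with `N` monomials vanishes at a positive point to order `≤ N − 1`
  (`LocalMultiplicity.rootMultiplicity_le_card_support_sub_one`, from Mathlib's Descartes rule of signs
  `Polynomial.roots_countP_pos_le_signVariations`; Pólya–Szegő, *Problems and Theorems in Analysis* II, Part V §6);
* `stub_local_2_3 : ¬ LocalRootLawAt 2 3 4` — the located rung `μ(2,3) = 5 = D(2,3)`: the explicit pencil
  `[[38,9],[9,2]] + t [[−12,−9],[−9,−3]] + t³ · 1` has determinant `(t − 1)⁵ (t + 5)`;
* `stub_local_2_4_record` — on the census record support `(0,2,6,11)` of format `(2,4)` (`9` distinct positive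
  roots in the census) NO symmetric pencil with non-zero determinant has a `9`-fold root at `1`:
  `μ(2,4;(0,2,6,11)) ≤ 8 < 9 = ζ(2,4;(0,2,6,11))` — the record is not totally coalescible.  Certificate: the
  `9`-fold-at-`1` coefficient vectors on the `10`-element sumset form ONE ray (apex polynomial `Q24 = (X−1)⁹·R24`,
  uniqueness by the sparse multiplicity bound), and the integer apex matrix built from it is non-singular, while
  the Gram-type coefficient matrix of four letters — dependent in `Sym₂(ℝ) ≅ ℝ³` — always has a kernel vector.
  Elementary rank argument; no Gram-realisability («C9») input.

Nothing here bears on `MatrixDescartes`, on the cell's Conjecture B (`KPlusLogSqLaw`), on the doors, or on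
`VP ≠ VNP`: a multiplicity census column is information about the format, not evidence for any law.
Axioms: `propext`, `Classical.choice`, `Quot.sound`.
-/

-- `Summit.ValiantsHypothesis.ValiantsHypothesis.…` repeats a component by the D-0017 layout
-- (single-conjunct summit), which the `dupNamespace` linter flags; the name is mandated.
set_option linter.dupNamespace false

namespace Summit.ValiantsHypothesis.ValiantsHypothesis.Theorems.LacunarySymmetroidMatrixDescartes

open Polynomial Finset
open scoped BigOperators Polynomial Matrix

namespace LocalMultiplicity

/-! ### 1. The sparse multiplicity bound: `N` monomials ⇒ order of vanishing `≤ N − 1` at every positive point -/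

/-- The number of sign variations of a real polynomial is at most the number of its non-zero
coefficients minus one. [folklore] -/
theorem signVariations_le_card_support_sub_one (P : ℝ[X]) :
    P.signVariations ≤ P.support.card - 1 := by
  -- adapted from Literature/LinearAlgebra/Matrix/GeneralizedVandermonde.lean (private helper there)
  induction h : P.support.card using Nat.strong_induction_on generalizing P with
  | _ k ih =>
    rcases Nat.lt_or_ge k 2 with hk | hk
    · obtain rfl | rfl : k = 0 ∨ k = 1 := by omega
      · have hP : P = 0 := by
          rw [Finset.card_eq_zero, Polynomial.support_eq_empty] at h
          exact h
        subst hP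
        simp
      · obtain ⟨d, c, _, rfl⟩ := Polynomial.card_support_eq_one.mp h
        rw [Polynomial.C_mul_X_pow_eq_monomial, Polynomial.signVariations_monomial]
    · have hcard : P.eraseLead.support.card = k - 1 := by
        rw [Polynomial.card_support_eraseLead, h]
      have hih := ih (k - 1) (by omega) P.eraseLead hcard
      calc P.signVariations ≤ P.eraseLead.signVariations + 1 :=
            Polynomial.signVariations_le_eraseLead_succ P
        _ ≤ k - 1 := by omega

/-- **Sparse multiplicity bound** (Pólya–Szegő V §6 for natural exponents, via Descartes' rule of signs):
a real polynomial with `N` non-zero coefficients vanishes to order at most `N − 1` at every POSITIVE point `a`: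
`rootMultiplicity a P = count of a among the roots ≤ #{positive roots with multiplicity} ≤ signVariations P ≤ N − 1`
(Mathlib `Polynomial.roots_countP_pos_le_signVariations`). [folklore] -/
theorem rootMultiplicity_le_card_support_sub_one (P : ℝ[X]) {a : ℝ} (ha : 0 < a) :
    P.rootMultiplicity a ≤ P.support.card - 1 := by
  classical
  have h1 : P.rootMultiplicity a ≤ P.roots.countP (0 < ·) := by
    rw [← Polynomial.count_roots, Multiset.count_eq_card_filter_eq, Multiset.countP_eq_card_filter]
    exact Multiset.card_le_card (Multiset.monotone_filter_right _ fun b hb => by rw [← hb]; exact ha)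
  exact h1.trans ((P.roots_countP_pos_le_signVariations).trans (signVariations_le_card_support_sub_one P))

/-- A sum of `t` monomials `∑ i, C (c i) * X ^ (e i)` has at most `t` non-zero coefficients. [folklore] -/
theorem card_support_sum_C_mul_X_pow_le {t : ℕ} (c : Fin t → ℝ) (e : Fin t → ℕ) :
    (∑ i, C (c i) * X ^ (e i) : ℝ[X]).support.card ≤ t := by
  have hsupp : (∑ i, C (c i) * X ^ (e i) : ℝ[X]).support ⊆ Finset.univ.image e := by
    intro n hn
    rw [Polynomial.mem_support_iff] at hn
    by_contra hnot
    apply hn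
    rw [Polynomial.finsetSum_coeff]
    refine Finset.sum_eq_zero fun i _ => ?_
    rw [Polynomial.coeff_C_mul_X_pow]
    have : n ≠ e i := fun hne => hnot (Finset.mem_image.2 ⟨i, Finset.mem_univ _, hne.symm⟩)
    simp [this]
  exact (Finset.card_le_card hsupp).trans (Finset.card_image_le.trans (by simp))

end LocalMultiplicity

open LocalMultiplicity in
/-- **Row `stub_localDescartes` — the local Descartes ceiling `μ(m, K) ≤ C(m+K−1, m) − 1`.**  The determinant of a
`K`-term `m × m` lacunary pencil has at most `C(m+K−1, m)` monomials (exponents are sums of `m` letters; tree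
`StubDescartesCeiling.card_support_det_pencil_le`), and a non-zero real polynomial with `N` monomials vanishes at
the positive point `t = 1` to order at most `N − 1` (`rootMultiplicity_le_card_support_sub_one`).  Symmetry of the
`S l` is not used. [folklore] -/
theorem stub_localDescartes (m K : ℕ) : LocalRootLawAt m K (Nat.choose (m + K - 1) m - 1) := by
  intro d S _ h0
  have h1 := rootMultiplicity_le_card_support_sub_one (pencilDet d S) one_pos
  have h2 : (pencilDet d S).support.card ≤ Nat.choose (m + K - 1) m :=
    StubDescartesCeiling.card_support_det_pencil_le d S
  exact h1.trans (Nat.sub_le_sub_right h2 1)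


namespace LocalMultiplicity

/-! ### 2. The located rung `(2,3)`: `μ(2,3) ≥ 5`, so `μ(2,3) = 5 = D(2,3)` with `stub_localDescartes 2 3` -/

/-- Exponents `d = (0, 1, 3)` of the `(2,3)` witness. -/
def d23 : Fin 3 → ℕ := ![0, 1, 3]

/-- Letters of the `(2,3)` witness: `S₀ = [[38, 9], [9, 2]]`, `S₁ = [[−12, −9], [−9, −3]]`, `S₂ = 1` — a realisation
in `(Sym₂(ℝ), det)` of the card's Gram matrix `[[−5, 12, 20], [12, −45, −15/2], [20, −15/2, 1]]`
(`det S₀ = −5`, `det S₁ = −45`, `det S₂ = 1`, polar forms `12, 20, −15/2`). -/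
def S23 : Fin 3 → Matrix (Fin 2) (Fin 2) ℝ := ![!![38, 9; 9, 2], !![-12, -9; -9, -3], !![1, 0; 0, 1]]

/-- The letters of the `(2,3)` witness are symmetric. -/
theorem S23_isSymm (l : Fin 3) : (S23 l).IsSymm := by
  fin_cases l <;> (rw [Matrix.IsSymm]; ext i j; fin_cases i <;> fin_cases j <;> rfl)

/-- The determinant of the `(2,3)` witness pencil `S₀ + t S₁ + t³ S₂` is
`t⁶ − 15t⁴ + 40t³ − 45t² + 24t − 5 = (t − 1)⁵ (t + 5)`. -/
theorem pencilDet_S23 : pencilDet d23 S23 = (X - C 1) ^ 5 * (X + C 5) := by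
  unfold pencilDet
  rw [Matrix.det_fin_two]
  simp [d23, S23, Matrix.sum_apply, Fin.sum_univ_three, C_ofNat]
  ring

/-- The `(2,3)` witness pencil has a non-zero determinant. -/
theorem pencilDet_S23_ne_zero : pencilDet d23 S23 ≠ 0 := by
  rw [pencilDet_S23]
  exact mul_ne_zero (pow_ne_zero _ (X_sub_C_ne_zero 1)) (monic_X_add_C 5).ne_zero

/-- The `(2,3)` witness vanishes at `t = 1` to order at least `5`. -/
theorem five_le_rootMultiplicity_S23 : 5 ≤ (pencilDet d23 S23).rootMultiplicity 1 := by
  rw [le_rootMultiplicity_iff pencilDet_S23_ne_zero]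
  exact ⟨X + C 5, pencilDet_S23⟩

end LocalMultiplicity

open LocalMultiplicity in
/-- **Row `stub_local_2_3` — the located rung `(2,3)`: `¬ LocalRootLawAt 2 3 4`, i.e. `μ(2,3) ≥ 5`** (with
`stub_localDescartes 2 3 : LocalRootLawAt 2 3 5` this is `μ(2,3) = 5 = D(2,3)`: local census = Descartes ceiling =
global census at `(2,3)`).  Witness: `d = (0,1,3)`, `S₀ = [[38,9],[9,2]]`, `S₁ = [[−12,−9],[−9,−3]]`, `S₂ = 1`, with
`det (S₀ + t S₁ + t³ S₂) = (t − 1)⁵ (t + 5)`. [folklore] -/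
theorem stub_local_2_3 : ¬ LocalRootLawAt 2 3 4 := by
  intro h
  have h5 := five_le_rootMultiplicity_S23
  have h4 := h d23 S23 S23_isSymm pencilDet_S23_ne_zero
  omega


namespace LocalMultiplicity

/-! ### 3. The census record support `(0,2,6,11)` at format `(2,4)`: no `9`-fold root at `t = 1`

The sumset of `d = (0,2,6,11)` is the `10`-element set `E = {0,2,4,6,8,11,12,13,17,22}` (Sidon), and for symmetric
letters `S l = [[a l, b l], [b l, c l]]` the pencil determinant is `∑_{e ∈ E} γ_e X^e` with the GRAM-TYPE
coefficients `γ_{2 d_l} = det S_l = a_l c_l − b_l²`, `γ_{d_l + d_l'} = a_l c_l' + a_l' c_l − 2 b_l b_l'` (`P24`).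
A `9`-fold root at `1` of a non-zero polynomial supported on `E` pins its coefficient vector to ONE ray, spanned by
`c⋆ = (−7875, 68068, −257125, 546975, −668525, 1414400, −1684683, 598400, −9856, 221)` (`Q24 = (X − 1)⁹ · R24`;
uniqueness: a second solution combines with `Q24` to a polynomial on `9` exponents with a `9`-fold root, which is
zero by the sparse multiplicity bound).  But `γ = λ c⋆` with `λ ≠ 0` is impossible: the four letters are linearly
dependent in `Sym₂(ℝ) ≅ ℝ³`, so the doubled Gram matrix `(a_l c_l' + a_l' c_l − 2 b_l b_l')_{l,l'}` has a non-zero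
kernel vector `μ`, whereas the corresponding integer matrix built from `c⋆`,
`D = [[−15750, 68068, 546975, 1414400], [68068, −514250, −668525, 598400], [546975, −668525, −3369366, −9856],
[1414400, 598400, −9856, 442]]`, is non-singular (`det D = −2246401283188666724227008`; in the proof the four
equations `D μ = 0` are solved to `μ = 0` by linear arithmetic).  Elementary rank argument — no Gram-realisability
(«C9») input. -/

/-- Exponents `d = (0, 2, 6, 11)` — the census record support at format `(2,4)` (`9` distinct positive roots,
`census/records/2-4.jsonl` id `E2-C-2-4-0-2-6-11-a`). -/
def d24 : Fin 4 → ℕ := ![0, 2, 6, 11]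

/-- MODEL of the pencil determinant on `(0,2,6,11)` for symmetric letters `[[a l, b l], [b l, c l]]`: the ten Gram-type
coefficients on the sumset `{0,2,4,6,8,11,12,13,17,22}`. -/
noncomputable def P24 (a b c : Fin 4 → ℝ) : ℝ[X] :=
  C (a 0 * c 0 - b 0 ^ 2)
  + C (a 0 * c 1 + a 1 * c 0 - 2 * b 0 * b 1) * X ^ 2
  + C (a 1 * c 1 - b 1 ^ 2) * X ^ 4
  + C (a 0 * c 2 + a 2 * c 0 - 2 * b 0 * b 2) * X ^ 6
  + C (a 1 * c 2 + a 2 * c 1 - 2 * b 1 * b 2) * X ^ 8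
  + C (a 0 * c 3 + a 3 * c 0 - 2 * b 0 * b 3) * X ^ 11
  + C (a 2 * c 2 - b 2 ^ 2) * X ^ 12
  + C (a 1 * c 3 + a 3 * c 1 - 2 * b 1 * b 3) * X ^ 13
  + C (a 2 * c 3 + a 3 * c 2 - 2 * b 2 * b 3) * X ^ 17
  + C (a 3 * c 3 - b 3 ^ 2) * X ^ 22

/-- The pencil determinant on `(0,2,6,11)` of symmetric `2 × 2` letters is the model `P24` of their entries. -/
theorem pencilDet_d24 (S : Fin 4 → Matrix (Fin 2) (Fin 2) ℝ) (hS : ∀ l, (S l).IsSymm) :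
    pencilDet d24 S = P24 (fun l => S l 0 0) (fun l => S l 0 1) (fun l => S l 1 1) := by
  have h10 : ∀ l, S l 1 0 = S l 0 1 := fun l => (hS l).apply 0 1
  unfold pencilDet P24
  rw [Matrix.det_fin_two]
  simp [Matrix.sum_apply, Fin.sum_univ_four, d24, h10, C_ofNat]
  ring

/-- The APEX polynomial: the (primitive integer) generator `∑ c⋆_e X^e` of the ray of polynomials supported on the
sumset of `(0,2,6,11)` with a `9`-fold root at `1`. -/
noncomputable def Q24 : ℝ[X] :=
  C (-7875) + C 68068 * X ^ 2 + C (-257125) * X ^ 4 + C 546975 * X ^ 6 + C (-668525) * X ^ 8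
  + C 1414400 * X ^ 11 + C (-1684683) * X ^ 12 + C 598400 * X ^ 13 + C (-9856) * X ^ 17 + C 221 * X ^ 22

/-- The cofactor `Q24 / (X − 1)⁹` (an integer polynomial of degree `13`, `R24 1 = 5348200 ≠ 0`). -/
noncomputable def R24 : ℝ[X] :=
  C 7875 + C 70875 * X + C 286307 * X ^ 2 + C 686763 * X ^ 3 + C 1092190 * X ^ 4 + C 1218030 * X ^ 5
  + C 978615 * X ^ 6 + C 574959 * X ^ 7 + C 274571 * X ^ 8 + C 109395 * X ^ 9 + C 36465 * X ^ 10
  + C 9945 * X ^ 11 + C 1989 * X ^ 12 + C 221 * X ^ 13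

/-- Certificate: the apex polynomial has a `9`-fold root at `t = 1`: `Q24 = (X − 1)⁹ · R24`. -/
theorem Q24_eq : Q24 = (X - C 1) ^ 9 * R24 := by
  simp only [Q24, R24, map_neg, C_ofNat, map_one]
  ring

/-- The nine exponents of the sumset below the top exponent `22`. -/
def e9 : Fin 9 → ℕ := ![0, 2, 4, 6, 8, 11, 12, 13, 17]

/-- Coefficients of the elimination `221 · P24 − γ₂₂ · Q24` on the nine exponents `e9`. -/
def f9 (a b c : Fin 4 → ℝ) : Fin 9 → ℝ :=
  ![221 * (a 0 * c 0 - b 0 ^ 2) - (a 3 * c 3 - b 3 ^ 2) * (-7875),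
    221 * (a 0 * c 1 + a 1 * c 0 - 2 * b 0 * b 1) - (a 3 * c 3 - b 3 ^ 2) * 68068,
    221 * (a 1 * c 1 - b 1 ^ 2) - (a 3 * c 3 - b 3 ^ 2) * (-257125),
    221 * (a 0 * c 2 + a 2 * c 0 - 2 * b 0 * b 2) - (a 3 * c 3 - b 3 ^ 2) * 546975,
    221 * (a 1 * c 2 + a 2 * c 1 - 2 * b 1 * b 2) - (a 3 * c 3 - b 3 ^ 2) * (-668525),
    221 * (a 0 * c 3 + a 3 * c 0 - 2 * b 0 * b 3) - (a 3 * c 3 - b 3 ^ 2) * 1414400,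
    221 * (a 2 * c 2 - b 2 ^ 2) - (a 3 * c 3 - b 3 ^ 2) * (-1684683),
    221 * (a 1 * c 3 + a 3 * c 1 - 2 * b 1 * b 3) - (a 3 * c 3 - b 3 ^ 2) * 598400,
    221 * (a 2 * c 3 + a 3 * c 2 - 2 * b 2 * b 3) - (a 3 * c 3 - b 3 ^ 2) * (-9856)]

/-- The elimination of the top exponent: `221 · P24 − γ₂₂ · Q24` is supported on the nine exponents `e9`. -/
theorem elim_eq_sum (a b c : Fin 4 → ℝ) :
    C 221 * P24 a b c - C (a 3 * c 3 - b 3 ^ 2) * Q24 = ∑ i : Fin 9, C (f9 a b c i) * X ^ (e9 i) := by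
  simp [P24, Q24, f9, e9, Fin.sum_univ_succ, C_ofNat]
  ring

/-- The letter matrix padded with a zero row: rows `a`, `b`, `c`, `0`.  Its kernel vectors are the linear
dependencies of the four letters `(a l, b l, c l) ∈ ℝ³`. -/
def N4 (a b c : Fin 4 → ℝ) : Matrix (Fin 4) (Fin 4) ℝ :=
  !![a 0, a 1, a 2, a 3; b 0, b 1, b 2, b 3; c 0, c 1, c 2, c 3; 0, 0, 0, 0]

/-- The padded letter matrix is singular (zero last row). -/
theorem det_N4 (a b c : Fin 4 → ℝ) : (N4 a b c).det = 0 :=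
  Matrix.det_eq_zero_of_row_eq_zero 3 fun j => by fin_cases j <;> simp [N4]

/-- **Core of the `(2,4)` record certificate.**  If the model determinant `P24 a b c` is non-zero, it vanishes at
`t = 1` to order at most `8`. -/
theorem rootMultiplicity_P24_le_eight (a b c : Fin 4 → ℝ) (h0 : P24 a b c ≠ 0) :
    (P24 a b c).rootMultiplicity 1 ≤ 8 := by
  by_contra hnot
  have h9 : (X - C 1) ^ 9 ∣ P24 a b c := (le_rootMultiplicity_iff h0).mp (by omega)
  -- eliminate the top exponent against the apex polynomial
  have hdvd : (X - C 1) ^ 9 ∣ C 221 * P24 a b c - C (a 3 * c 3 - b 3 ^ 2) * Q24 :=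
    dvd_sub (h9.mul_left _) ((Dvd.intro _ Q24_eq.symm).mul_left _)
  have hcard : (C 221 * P24 a b c - C (a 3 * c 3 - b 3 ^ 2) * Q24).support.card ≤ 9 := by
    rw [elim_eq_sum]
    exact card_support_sum_C_mul_X_pow_le _ _
  -- a `9`-nomial with a `9`-fold root at `1` is zero
  have hzero : C 221 * P24 a b c - C (a 3 * c 3 - b 3 ^ 2) * Q24 = 0 := by
    by_contra hne
    have h1 := (le_rootMultiplicity_iff hne).mpr hdvd
    have h2 := rootMultiplicity_le_card_support_sub_one
      (C 221 * P24 a b c - C (a 3 * c 3 - b 3 ^ 2) * Q24) one_pos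
    omega
  have hc : ∀ n, (C 221 * P24 a b c).coeff n = (C (a 3 * c 3 - b 3 ^ 2) * Q24).coeff n :=
    fun n => by rw [sub_eq_zero.mp hzero]
  -- the coefficient identities `221 · γ_e = γ₂₂ · c⋆_e`
  have E0 : 221 * (a 0 * c 0 - b 0 ^ 2) = (a 3 * c 3 - b 3 ^ 2) * (-7875) := by
    have := hc 0
    simp only [coeff_add, coeff_C_mul, coeff_X_pow, coeff_C, mul_ite, mul_one, mul_zero, P24, Q24] at this
    norm_num at this
    linarith
  have E2 : 221 * (a 0 * c 1 + a 1 * c 0 - 2 * b 0 * b 1) = (a 3 * c 3 - b 3 ^ 2) * 68068 := by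
    have := hc 2
    simp only [coeff_add, coeff_C_mul, coeff_X_pow, coeff_C, mul_ite, mul_one, mul_zero, P24, Q24] at this
    norm_num at this
    linarith
  have E4 : 221 * (a 1 * c 1 - b 1 ^ 2) = (a 3 * c 3 - b 3 ^ 2) * (-257125) := by
    have := hc 4
    simp only [coeff_add, coeff_C_mul, coeff_X_pow, coeff_C, mul_ite, mul_one, mul_zero, P24, Q24] at this
    norm_num at this
    linarith
  have E6 : 221 * (a 0 * c 2 + a 2 * c 0 - 2 * b 0 * b 2) = (a 3 * c 3 - b 3 ^ 2) * 546975 := by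
    have := hc 6
    simp only [coeff_add, coeff_C_mul, coeff_X_pow, coeff_C, mul_ite, mul_one, mul_zero, P24, Q24] at this
    norm_num at this
    linarith
  have E8 : 221 * (a 1 * c 2 + a 2 * c 1 - 2 * b 1 * b 2) = (a 3 * c 3 - b 3 ^ 2) * (-668525) := by
    have := hc 8
    simp only [coeff_add, coeff_C_mul, coeff_X_pow, coeff_C, mul_ite, mul_one, mul_zero, P24, Q24] at this
    norm_num at this
    linarith
  have E11 : 221 * (a 0 * c 3 + a 3 * c 0 - 2 * b 0 * b 3) = (a 3 * c 3 - b 3 ^ 2) * 1414400 := by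
    have := hc 11
    simp only [coeff_add, coeff_C_mul, coeff_X_pow, coeff_C, mul_ite, mul_one, mul_zero, P24, Q24] at this
    norm_num at this
    linarith
  have E12 : 221 * (a 2 * c 2 - b 2 ^ 2) = (a 3 * c 3 - b 3 ^ 2) * (-1684683) := by
    have := hc 12
    simp only [coeff_add, coeff_C_mul, coeff_X_pow, coeff_C, mul_ite, mul_one, mul_zero, P24, Q24] at this
    norm_num at this
    linarith
  have E13 : 221 * (a 1 * c 3 + a 3 * c 1 - 2 * b 1 * b 3) = (a 3 * c 3 - b 3 ^ 2) * 598400 := by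
    have := hc 13
    simp only [coeff_add, coeff_C_mul, coeff_X_pow, coeff_C, mul_ite, mul_one, mul_zero, P24, Q24] at this
    norm_num at this
    linarith
  have E17 : 221 * (a 2 * c 3 + a 3 * c 2 - 2 * b 2 * b 3) = (a 3 * c 3 - b 3 ^ 2) * (-9856) := by
    have := hc 17
    simp only [coeff_add, coeff_C_mul, coeff_X_pow, coeff_C, mul_ite, mul_one, mul_zero, P24, Q24] at this
    norm_num at this
    linarith
  set g : ℝ := a 3 * c 3 - b 3 ^ 2 with hg
  rcases eq_or_ne g 0 with hg0 | hg0
  · -- `γ₂₂ = 0` forces every Gram coefficient to vanish: `P24 = 0`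
    apply h0
    have z0 : a 0 * c 0 - b 0 ^ 2 = 0 := by rw [hg0] at E0; linarith
    have z2 : a 0 * c 1 + a 1 * c 0 - 2 * b 0 * b 1 = 0 := by rw [hg0] at E2; linarith
    have z4 : a 1 * c 1 - b 1 ^ 2 = 0 := by rw [hg0] at E4; linarith
    have z6 : a 0 * c 2 + a 2 * c 0 - 2 * b 0 * b 2 = 0 := by rw [hg0] at E6; linarith
    have z8 : a 1 * c 2 + a 2 * c 1 - 2 * b 1 * b 2 = 0 := by rw [hg0] at E8; linarith
    have z11 : a 0 * c 3 + a 3 * c 0 - 2 * b 0 * b 3 = 0 := by rw [hg0] at E11; linarith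
    have z12 : a 2 * c 2 - b 2 ^ 2 = 0 := by rw [hg0] at E12; linarith
    have z13 : a 1 * c 3 + a 3 * c 1 - 2 * b 1 * b 3 = 0 := by rw [hg0] at E13; linarith
    have z17 : a 2 * c 3 + a 3 * c 2 - 2 * b 2 * b 3 = 0 := by rw [hg0] at E17; linarith
    have z22 : a 3 * c 3 - b 3 ^ 2 = 0 := hg ▸ hg0
    simp only [P24, z0, z2, z4, z6, z8, z11, z12, z13, z17, z22, map_zero, zero_mul, add_zero]
  · -- the four letters are dependent in `Sym₂(ℝ) ≅ ℝ³`
    obtain ⟨μ, hμ, hN⟩ : ∃ μ : Fin 4 → ℝ, μ ≠ 0 ∧ N4 a b c *ᵥ μ = 0 := by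
      obtain ⟨v, hv, hv0⟩ := Matrix.exists_mulVec_eq_zero_iff.mpr (det_N4 a b c)
      exact ⟨v, hv, hv0⟩
    have Ha : a 0 * μ 0 + a 1 * μ 1 + a 2 * μ 2 + a 3 * μ 3 = 0 := by
      have := congrFun hN 0
      simpa [N4, Matrix.mulVec, dotProduct, Fin.sum_univ_four] using this
    have Hb : b 0 * μ 0 + b 1 * μ 1 + b 2 * μ 2 + b 3 * μ 3 = 0 := by
      have := congrFun hN 1
      simpa [N4, Matrix.mulVec, dotProduct, Fin.sum_univ_four] using this
    have Hc : c 0 * μ 0 + c 1 * μ 1 + c 2 * μ 2 + c 3 * μ 3 = 0 := by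
      have := congrFun hN 2
      simpa [N4, Matrix.mulVec, dotProduct, Fin.sum_univ_four] using this
    -- hence `μ` is in the kernel of the (doubled) Gram matrix, i.e. of the integer apex matrix `D`
    have r0 : -15750 * μ 0 + 68068 * μ 1 + 546975 * μ 2 + 1414400 * μ 3 = 0 := by
      apply mul_left_cancel₀ hg0
      linear_combination (-2 * μ 0) * E0 - μ 1 * E2 - μ 2 * E6 - μ 3 * E11
        + 221 * a 0 * Hc + 221 * c 0 * Ha - 442 * b 0 * Hb
    have r1 : 68068 * μ 0 - 514250 * μ 1 - 668525 * μ 2 + 598400 * μ 3 = 0 := by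
      apply mul_left_cancel₀ hg0
      linear_combination (-(μ 0)) * E2 - 2 * μ 1 * E4 - μ 2 * E8 - μ 3 * E13
        + 221 * a 1 * Hc + 221 * c 1 * Ha - 442 * b 1 * Hb
    have r2 : 546975 * μ 0 - 668525 * μ 1 - 3369366 * μ 2 - 9856 * μ 3 = 0 := by
      apply mul_left_cancel₀ hg0
      linear_combination (-(μ 0)) * E6 - μ 1 * E8 - 2 * μ 2 * E12 - μ 3 * E17
        + 221 * a 2 * Hc + 221 * c 2 * Ha - 442 * b 2 * Hb
    have r3 : 1414400 * μ 0 + 598400 * μ 1 - 9856 * μ 2 + 442 * μ 3 = 0 := by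
      apply mul_left_cancel₀ hg0
      linear_combination (-(μ 0)) * E11 - μ 1 * E13 - μ 2 * E17 + 442 * μ 3 * hg
        + 221 * a 3 * Hc + 221 * c 3 * Ha - 442 * b 3 * Hb
    -- `D` is non-singular: `μ = 0`
    have m0 : μ 0 = 0 := by linarith
    have m1 : μ 1 = 0 := by linarith
    have m2 : μ 2 = 0 := by linarith
    have m3 : μ 3 = 0 := by linarith
    exact hμ (funext fun i => by fin_cases i <;> assumption)

end LocalMultiplicity

open LocalMultiplicity in
/-- **Row `stub_local_2_4_record` — the census record support `(0,2,6,11)` at `(2,4)` is NOT totally coalescible: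
`μ(2,4; (0,2,6,11)) ≤ 8 < 9 = ζ(2,4; (0,2,6,11))`.**  For every real symmetric `2 × 2` pencil on the exponents
`(0,2,6,11)` with non-zero determinant, the determinant vanishes at `t = 1` to order at most `8` — although the
census records `9` distinct positive roots on this support.  Certificate (`LocalMultiplicity.rootMultiplicity_P24_le_eight`):
the `9`-fold coefficient vector on the `10`-element sumset is the single ray `c⋆` (`Q24 = (X−1)⁹ R24` + the sparse
multiplicity bound), and the apex matrix `D` built from `c⋆` is non-singular while the Gram-type matrix of four
dependent letters in `Sym₂(ℝ) ≅ ℝ³` has a kernel vector.  Elementary (no Gram-realisability input); instrument tier: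
a multiplicity census entry, nothing about `MatrixDescartes`, Conjecture B, or `VP ≠ VNP`. [folklore] -/
theorem stub_local_2_4_record (S : Fin 4 → Matrix (Fin 2) (Fin 2) ℝ) (hS : ∀ l, (S l).IsSymm)
    (h0 : pencilDet (![0, 2, 6, 11] : Fin 4 → ℕ) S ≠ 0) :
    (pencilDet (![0, 2, 6, 11] : Fin 4 → ℕ) S).rootMultiplicity 1 ≤ 8 := by
  change (pencilDet d24 S).rootMultiplicity 1 ≤ 8
  change pencilDet d24 S ≠ 0 at h0
  rw [pencilDet_d24 S hS] at h0 ⊢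
  exact rootMultiplicity_P24_le_eight _ _ _ h0

end Summit.ValiantsHypothesis.ValiantsHypothesis.Theorems.LacunarySymmetroidMatrixDescartes
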